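import Literature.AlgebraicTopology.KTheory.MappingCone
import Literature.AlgebraicTopology.KTheory.SphereModels
import Literature.AlgebraicTopology.KTheory.CollapseHomotopy
import Literature.AlgebraicTopology.KTheory.SphereSmash
import Literature.AlgebraicTopology.KTheory.WedgeCollapse
import HarnessLib

/-!
# Topology for Hatcher's Lemma 2.18: the disc quotient, faces, slices and hemisphere embeddings

The point-set input for the identity `α² = ±β` in the `K`-theory of the mapping cone of the
Hopf construction (Hatcher, *VBKT* §2.3 Lemma 2.18), for the cone `C` of `MappingCone.lean`:

* §1 the disc quotient `Dᵈ/∂Dᵈ` (`DS d`) and `Dᵈ/∂Dᵈ ≃ₜ Sᵈ` (`dsHomeoRound`, base point to the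
  pole);
* §2 the faces `∂D × D`, `D × ∂D` as closed sets, `∂(D × D) = ∂D × D ∪ D × ∂D`, the projections
  `ρ_A : DD/(∂D × D) → D/∂D`, `ρ_B`, and the **homeomorphism
  `σ : DD/∂(DD) ≃ₜ (D/∂D) ∧ (D/∂D)`**;
* §3 slices `x ↦ (x, e₀)`, `y ↦ (e₀, y)` and the **linear homotopies of pairs**
  `(DD, ∂D × D) → (DD, ∂D × D)` from the identity to `slice ∘ pr₁` (`homotopyA`, `homotopyB`);
* §4 the closed hemispheres as closed sets, the hemisphere embeddings `x ↦ (x, ∓√(1-|x|²))` of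
  `D` into `Sᵈ` and the **homeomorphisms `D/∂D ≃ₜ Sᵈ/D₊`, `D/∂D ≃ₜ Sᵈ/D₋`** (`lamA`, `lamB`);
* §5 the families `(t, x) ↦ (|x| K_t(x/|x|), ∓√(1-|x|²))` through which an `H`-space unit
  homotopy `K` deforms `ĝ(·, e₀)` (resp. `ĝ(e₀, ·)`) into the hemisphere embedding
  (`homotopyTauA`, `homotopyTauB`), as homotopies of maps of pairs `(D, ∂D) → (Sᵈ, D_±)`.

## References

* A. Hatcher, *Vector Bundles and K-Theory* (v2.2, 2017), §2.3, proof of Lemma 2.18.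
  [HatcherVBKT2017]
* A. Hatcher, *Algebraic Topology* (2002), Ch. 0. [HatcherAT2002]
-/

noncomputable section

open Set Metric Topology TopologicalSpace unitInterval Filter

namespace Literature.AlgebraicTopology.KTheory

variable {d : ℕ}

/-! ### 1. The disc quotient `Dᵈ/∂Dᵈ ≅ Sᵈ` -/

section DiscQuotient

/-- The boundary sphere of the disc. [folklore] -/
def sphS (d : ℕ) : Set (Dd d) := {v | ‖(v : Vd d)‖ = 1}

/-- Lemma 2.18 topology (Hatcher VBKT §2.3). [folklore] -/
theorem mem_sphS {v : Dd d} : v ∈ sphS d ↔ ‖(v : Vd d)‖ = 1 := Iff.rfl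

/-- Lemma 2.18 topology (Hatcher VBKT §2.3). [folklore] -/
theorem isClosed_sphS : IsClosed (sphS d) := isClosed_eq (continuous_norm.comp continuous_subtype_val) continuous_const

/-- The boundary sphere as a closed set. [folklore] -/
def sphC (d : ℕ) : Closeds (Dd d) := ⟨sphS d, isClosed_sphS⟩

/-- Lemma 2.18 topology (Hatcher VBKT §2.3). [folklore] -/
@[simp] theorem coe_sphC : ((sphC d : Closeds (Dd d)) : Set (Dd d)) = sphS d := rfl

/-- `Dᵈ/∂Dᵈ`. [folklore] -/
abbrev DS (d : ℕ) : Type := Collapse (Dd d) (sphC d)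

/-- Its base point. [folklore] -/
abbrev dsPt (d : ℕ) : DS d := Collapse.pt (sphC d)

/-- The open disc. [folklore] -/
def openD (d : ℕ) : Set (Dd d) := {v | ‖(v : Vd d)‖ < 1}

/-- Lemma 2.18 topology (Hatcher VBKT §2.3). [folklore] -/
theorem isOpen_openD : IsOpen (openD d) := isOpen_lt (continuous_norm.comp continuous_subtype_val) continuous_const

/-- Lemma 2.18 topology (Hatcher VBKT §2.3). [folklore] -/
theorem disjoint_openD_sphS : Disjoint (openD d) (sphC d : Set (Dd d)) := by
  rw [Set.disjoint_left]; intro v hv hs; rw [coe_sphC, mem_sphS] at hs; change ‖(v : Vd d)‖ < 1 at hv; linarith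

/-- The open disc is the open unit ball. [folklore] -/
def openDHomeoBall : ↥(openD d) ≃ₜ ↥(ball (0 : Vd d) 1) where
  toFun v := ⟨((v : Dd d) : Vd d), mem_ball_zero_iff.2 v.2⟩
  invFun u := ⟨⟨(u : Vd d), ball_subset_closedBall u.2⟩, mem_ball_zero_iff.1 u.2⟩
  left_inv _ := rfl
  right_inv _ := rfl
  continuous_toFun := (continuous_subtype_val.comp continuous_subtype_val).subtype_mk _
  continuous_invFun := (continuous_subtype_val.subtype_mk _).subtype_mk _

/-- The interior of the disc embeds openly into `Dᵈ/∂Dᵈ`. [folklore] -/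
theorem isOpenEmbedding_mk_openD : IsOpenEmbedding fun v : ↥(openD d) ↦ Collapse.mk (sphC d) (v : Dd d) := by
  refine IsOpenEmbedding.of_continuous_injective_isOpenMap ((Collapse.mk (sphC d)).continuous.comp continuous_subtype_val) ?_ ?_
  · intro v v' h
    rcases (Collapse.mk_eq_mk_iff (A := sphC d)).1 h with h' | ⟨h', -⟩
    · exact Subtype.ext h'
    · exact absurd h' (Set.disjoint_left.1 disjoint_openD_sphS v.2)
  · intro U hU
    have h1 : (fun v : ↥(openD d) ↦ Collapse.mk (sphC d) (v : Dd d)) '' U = Collapse.mk (sphC d) '' (Subtype.val '' U) := (image_image _ _ _).symm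
    rw [h1]
    refine Collapse.isOpen_image_mk (isOpen_openD.isOpenMap_subtype_val U hU) ?_
    exact Set.disjoint_of_subset_left (by rintro _ ⟨w, -, rfl⟩; exact w.2) disjoint_openD_sphS

/-- Lemma 2.18 topology (Hatcher VBKT §2.3). [folklore] -/
theorem range_mk_openD : range (fun v : ↥(openD d) ↦ Collapse.mk (sphC d) (v : Dd d)) = {dsPt d}ᶜ := by
  ext z
  constructor
  · rintro ⟨v, rfl⟩ h
    exact Set.disjoint_left.1 disjoint_openD_sphS v.2 ((Collapse.mk_eq_pt_iff (A := sphC d)).1 h)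
  · intro hz
    rcases Collapse.eq_pt_or_eq_mk z with rfl | ⟨v, hv, rfl⟩
    · exact absurd rfl hz
    · refine ⟨⟨v, ?_⟩, rfl⟩
      have hv' : ‖(v : Vd d)‖ ≠ 1 := hv
      exact lt_of_le_of_ne (mem_closedBall_zero_iff.1 v.2) hv'

/-- `OnePoint` of the open disc is `Dᵈ/∂Dᵈ`, `∞ ↦ pt`. [folklore] -/
def onePointOpenDHomeo : OnePoint ↥(openD d) ≃ₜ DS d :=
  OnePoint.equivOfIsEmbeddingOfRangeEq (dsPt d) _ isOpenEmbedding_mk_openD.isEmbedding range_mk_openD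

/-- **`Dᵈ/∂Dᵈ ≃ₜ Sᵈ`, base point to the pole.** [cite: HatcherAT2002, Ch. 0 Example 0.3] -/
def dsHomeoRound : DS d ≃ₜ sphere (0 : EuclideanSpace ℝ (Fin (d + 1))) 1 :=
  onePointOpenDHomeo.symm.trans ((openDHomeoBall.trans (Homeomorph.unitBall (E := Vd d)).symm).onePointCongr.trans
    (onePointHomeoSphere (Vd d) d finrank_euclideanSpace_fin))

/-- Lemma 2.18 topology (Hatcher VBKT §2.3). [folklore] -/
@[simp] theorem dsHomeoRound_pt : dsHomeoRound (dsPt d) = pole d := by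
  rw [dsHomeoRound, Homeomorph.trans_apply, Homeomorph.trans_apply]
  have h1 : (onePointOpenDHomeo (d := d)).symm (dsPt d) = OnePoint.infty := by
    rw [Homeomorph.symm_apply_eq]; rfl
  rw [h1]
  rfl

end DiscQuotient

/-! ### 2. Faces, projections and `DD/∂(DD) ≅ (D/∂D) ∧ (D/∂D)` -/

section Faces

/-- `∂D × D` as a closed set. [folklore] -/
def faceAC (d : ℕ) : Closeds (DD d) := ⟨faceA d, isClosed_faceA⟩

/-- `D × ∂D` as a closed set. [folklore] -/
def faceBC (d : ℕ) : Closeds (DD d) := ⟨faceB d, isClosed_faceB⟩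

/-- Lemma 2.18 topology (Hatcher VBKT §2.3). [folklore] -/
@[simp] theorem coe_faceAC : ((faceAC d : Closeds (DD d)) : Set (DD d)) = faceA d := rfl

/-- Lemma 2.18 topology (Hatcher VBKT §2.3). [folklore] -/
@[simp] theorem coe_faceBC : ((faceBC d : Closeds (DD d)) : Set (DD d)) = faceB d := rfl

/-- **`∂(D × D) = ∂D × D ∪ D × ∂D`** as closed sets. [folklore] -/
theorem faceAC_sup_faceBC : faceAC d ⊔ faceBC d = bdryC d := by
  apply SetLike.coe_injective
  change faceA d ∪ faceB d = bdry d
  exact bdry_eq_faceA_union_faceB.symm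

/-- Lemma 2.18 topology (Hatcher VBKT §2.3). [folklore] -/
theorem mem_faceAC_sup_faceBC_iff {w : DD d} : w ∈ faceAC d ⊔ faceBC d ↔ w ∈ faceA d ∨ w ∈ faceB d := by
  change w ∈ ((faceAC d ⊔ faceBC d : Closeds (DD d)) : Set (DD d)) ↔ _
  rw [Closeds.coe_sup]; rfl

/-- The projection `DD/(∂D × D) → D/∂D` to the first factor. [folklore] -/
def rhoA : C(Collapse (DD d) (faceAC d), DS d) :=
  Collapse.map ⟨fun w : DD d ↦ w.1, continuous_fst⟩ fun _ hw ↦ hw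

/-- The projection `DD/(D × ∂D) → D/∂D` to the second factor. [folklore] -/
def rhoB : C(Collapse (DD d) (faceBC d), DS d) :=
  Collapse.map ⟨fun w : DD d ↦ w.2, continuous_snd⟩ fun _ hw ↦ hw

/-- Lemma 2.18 topology (Hatcher VBKT §2.3). [folklore] -/
@[simp] theorem rhoA_mk (w : DD d) : rhoA (Collapse.mk (faceAC d) w) = Collapse.mk (sphC d) w.1 := rfl

/-- Lemma 2.18 topology (Hatcher VBKT §2.3). [folklore] -/
@[simp] theorem rhoB_mk (w : DD d) : rhoB (Collapse.mk (faceBC d) w) = Collapse.mk (sphC d) w.2 := rfl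

/-- Lemma 2.18 topology (Hatcher VBKT §2.3). [folklore] -/
@[simp] theorem rhoA_pt : rhoA (Collapse.pt (faceAC d)) = dsPt d := rfl

/-- Lemma 2.18 topology (Hatcher VBKT §2.3). [folklore] -/
@[simp] theorem rhoB_pt : rhoB (Collapse.pt (faceBC d)) = dsPt d := rfl

/-- The map `DD/∂(DD) → (D/∂D) ∧ (D/∂D)`, `[(x, y)] ↦ [[x], [y]]`. [cite: HatcherAT2002, Ch. 0 p. 10] -/
def sigMap : C(Collapse (DD d) (faceAC d ⊔ faceBC d), Collapse (DS d × DS d) (prodWedgeC (dsPt d) (dsPt d))) :=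
  Collapse.lift ((Collapse.mk (prodWedgeC (dsPt d) (dsPt d))).comp ((Collapse.mk (sphC d)).prodMap (Collapse.mk (sphC d))))
    (Collapse.pt _) fun w hw ↦ by
      rcases mem_faceAC_sup_faceBC_iff.1 hw with h | h
      · exact Collapse.mk_eq_pt (Or.inl (Collapse.mk_eq_pt h))
      · exact Collapse.mk_eq_pt (Or.inr (Collapse.mk_eq_pt h))

/-- Lemma 2.18 topology (Hatcher VBKT §2.3). [folklore] -/
@[simp] theorem sigMap_mk (w : DD d) :
    sigMap (Collapse.mk (faceAC d ⊔ faceBC d) w) = Collapse.mk (prodWedgeC (dsPt d) (dsPt d)) (Collapse.mk (sphC d) w.1, Collapse.mk (sphC d) w.2) := rfl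

/-- Lemma 2.18 topology (Hatcher VBKT §2.3). [folklore] -/
@[simp] theorem sigMap_pt : sigMap (Collapse.pt (faceAC d ⊔ faceBC d)) = Collapse.pt _ := rfl

/-- Lemma 2.18 topology (Hatcher VBKT §2.3). [folklore] -/
theorem mem_faces_of_mk_mem_prodWedge {w : DD d}
    (h : (Collapse.mk (sphC d) w.1, Collapse.mk (sphC d) w.2) ∈ prodWedge (dsPt d) (dsPt d)) : w ∈ faceAC d ⊔ faceBC d := by
  rw [mem_faceAC_sup_faceBC_iff]
  rcases h with h | h
  · exact Or.inl ((Collapse.mk_eq_pt_iff (A := sphC d)).1 h)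
  · exact Or.inr ((Collapse.mk_eq_pt_iff (A := sphC d)).1 h)

/-- Lemma 2.18 topology (Hatcher VBKT §2.3). [folklore] -/
theorem sigMap_bijective : Function.Bijective (sigMap : Collapse (DD d) (faceAC d ⊔ faceBC d) → Collapse (DS d × DS d) (prodWedgeC (dsPt d) (dsPt d))) := by
  constructor
  · intro z z' h
    rcases Collapse.eq_pt_or_eq_mk z with rfl | ⟨w, hw, rfl⟩ <;> rcases Collapse.eq_pt_or_eq_mk z' with rfl | ⟨w', hw', rfl⟩
    · rfl
    · exfalso
      rw [sigMap_pt, sigMap_mk, eq_comm, Collapse.mk_eq_pt_iff] at h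
      exact hw' (mem_faces_of_mk_mem_prodWedge h)
    · exfalso
      rw [sigMap_pt, sigMap_mk, Collapse.mk_eq_pt_iff] at h
      exact hw (mem_faces_of_mk_mem_prodWedge h)
    · rw [sigMap_mk, sigMap_mk, Collapse.mk_eq_mk_iff] at h
      rcases h with h | ⟨h, -⟩
      · simp only [Prod.mk.injEq] at h
        rcases h with ⟨h1, h2⟩
        rcases (Collapse.mk_eq_mk_iff (A := sphC d)).1 h1 with h1 | ⟨h1, -⟩
        · rcases (Collapse.mk_eq_mk_iff (A := sphC d)).1 h2 with h2 | ⟨h2, -⟩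
          · rw [Prod.ext h1 h2]
          · exact absurd (mem_faceAC_sup_faceBC_iff.2 (Or.inr h2)) hw
        · exact absurd (mem_faceAC_sup_faceBC_iff.2 (Or.inl h1)) hw
      · exact absurd (mem_faces_of_mk_mem_prodWedge h) hw
  · intro s
    rcases Collapse.eq_pt_or_eq_mk s with rfl | ⟨⟨z₁, z₂⟩, -, rfl⟩
    · exact ⟨Collapse.pt _, rfl⟩
    · rcases Collapse.eq_pt_or_eq_mk z₁ with rfl | ⟨x, -, rfl⟩
      · exact ⟨Collapse.pt _, (Collapse.mk_eq_pt (Or.inl rfl)).symm⟩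
      · rcases Collapse.eq_pt_or_eq_mk z₂ with rfl | ⟨y, -, rfl⟩
        · exact ⟨Collapse.pt _, (Collapse.mk_eq_pt (Or.inr rfl)).symm⟩
        · exact ⟨Collapse.mk _ (x, y), rfl⟩

/-- **`DD/∂(DD) ≃ₜ (D/∂D) ∧ (D/∂D)`.** [cite: HatcherAT2002, Ch. 0 p. 10] -/
def sig : Collapse (DD d) (faceAC d ⊔ faceBC d) ≃ₜ Collapse (DS d × DS d) (prodWedgeC (dsPt d) (dsPt d)) :=
  Continuous.homeoOfEquivCompactToT2 (f := Equiv.ofBijective _ sigMap_bijective) sigMap.continuous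

/-- Lemma 2.18 topology (Hatcher VBKT §2.3). [folklore] -/
theorem coe_sig : ((sig : Collapse (DD d) (faceAC d ⊔ faceBC d) ≃ₜ Collapse (DS d × DS d) (prodWedgeC (dsPt d) (dsPt d))) :
    C(Collapse (DD d) (faceAC d ⊔ faceBC d), Collapse (DS d × DS d) (prodWedgeC (dsPt d) (dsPt d)))) = sigMap := rfl

/-- Lemma 2.18 topology (Hatcher VBKT §2.3). [folklore] -/
@[simp] theorem sig_pt : sig (Collapse.pt (faceAC d ⊔ faceBC d)) = Collapse.pt _ := rfl

end Faces

/-! ### 3. Slices and the linear homotopies of pairs -/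

section Slices

variable (e₀ : Sd1 d)

/-- The unit `e₀` as a point of the disc. [folklore] -/
def discPt : Dd d := ⟨(e₀ : Vd d), mem_closedBall_zero_iff.2 (mem_sphere_zero_iff_norm.1 e₀.2).le⟩

/-- Lemma 2.18 topology (Hatcher VBKT §2.3). [folklore] -/
@[simp] theorem coe_discPt : ((discPt e₀ : Dd d) : Vd d) = e₀ := rfl

/-- Lemma 2.18 topology (Hatcher VBKT §2.3). [folklore] -/
theorem norm_discPt : ‖((discPt e₀ : Dd d) : Vd d)‖ = 1 := mem_sphere_zero_iff_norm.1 e₀.2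

/-- Lemma 2.18 topology (Hatcher VBKT §2.3). [folklore] -/
theorem discPt_mem_sphS : discPt e₀ ∈ sphS d := norm_discPt e₀

/-- The slice `x ↦ (x, e₀)`. [folklore] -/
def sliceA : C(Dd d, DD d) := (ContinuousMap.id _).prodMk (ContinuousMap.const _ (discPt e₀))

/-- The slice `y ↦ (e₀, y)`. [folklore] -/
def sliceB : C(Dd d, DD d) := (ContinuousMap.const _ (discPt e₀)).prodMk (ContinuousMap.id _)

/-- Lemma 2.18 topology (Hatcher VBKT §2.3). [folklore] -/
@[simp] theorem sliceA_apply (x : Dd d) : sliceA e₀ x = (x, discPt e₀) := rfl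

/-- Lemma 2.18 topology (Hatcher VBKT §2.3). [folklore] -/
@[simp] theorem sliceB_apply (y : Dd d) : sliceB e₀ y = (discPt e₀, y) := rfl

/-- Lemma 2.18 topology (Hatcher VBKT §2.3). [folklore] -/
theorem rad_sliceA (x : Dd d) : rad (sliceA e₀ x) = 1 :=
  le_antisymm (rad_le_one _) (by rw [sliceA_apply, rad, norm_discPt]; exact le_max_right _ _)

/-- Lemma 2.18 topology (Hatcher VBKT §2.3). [folklore] -/
theorem rad_sliceB (y : Dd d) : rad (sliceB e₀ y) = 1 :=
  le_antisymm (rad_le_one _) (by rw [sliceB_apply, rad, norm_discPt]; exact le_max_left _ _)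

/-- Lemma 2.18 topology (Hatcher VBKT §2.3). [folklore] -/
theorem mapsTo_sliceA : MapsTo (sliceA e₀) (sphC d : Set (Dd d)) (faceAC d : Set (DD d)) := fun _ hx ↦ hx

/-- Lemma 2.18 topology (Hatcher VBKT §2.3). [folklore] -/
theorem mapsTo_sliceB : MapsTo (sliceB e₀) (sphC d : Set (Dd d)) (faceBC d : Set (DD d)) := fun _ hy ↦ hy

/-- The convex combination `(1 - t) y + t e₀` in the disc. [folklore] -/
def convPt (t : I) (y : Dd d) : Dd d :=
  ⟨(1 - (t : ℝ)) • (y : Vd d) + (t : ℝ) • (e₀ : Vd d),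
    (convex_closedBall (0 : Vd d) 1) y.2 (discPt e₀).2 (sub_nonneg.2 t.2.2) t.2.1 (by ring)⟩

/-- Lemma 2.18 topology (Hatcher VBKT §2.3). [folklore] -/
theorem continuous_convPt : Continuous fun p : I × Dd d ↦ convPt e₀ p.1 p.2 := by
  refine Continuous.subtype_mk ?_ _
  exact ((continuous_const.sub (continuous_subtype_val.comp continuous_fst)).smul (continuous_subtype_val.comp continuous_snd)).add
    ((continuous_subtype_val.comp continuous_fst).smul continuous_const)

/-- Lemma 2.18 topology (Hatcher VBKT §2.3). [folklore] -/
theorem convPt_zero (y : Dd d) : convPt e₀ 0 y = y := Subtype.ext (by simp [convPt])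

/-- Lemma 2.18 topology (Hatcher VBKT §2.3). [folklore] -/
theorem convPt_one (y : Dd d) : convPt e₀ 1 y = discPt e₀ := Subtype.ext (by simp [convPt])

/-- **The linear homotopy of pairs `(DD, ∂D × D) → (DD, ∂D × D)` from the identity to
`(x, y) ↦ (x, e₀)`.** [cite: HatcherVBKT2017, §2.3 proof of Lemma 2.18] -/
def homotopyA : (ContinuousMap.id (DD d)).Homotopy ((sliceA e₀).comp ⟨fun w : DD d ↦ w.1, continuous_fst⟩) where
  toFun p := (p.2.1, convPt e₀ p.1 p.2.2)
  continuous_toFun := (continuous_fst.comp continuous_snd).prodMk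
    ((continuous_convPt e₀).comp (continuous_fst.prodMk (continuous_snd.comp continuous_snd)))
  map_zero_left w := by change (w.1, convPt e₀ 0 w.2) = w; rw [convPt_zero]
  map_one_left w := by change (w.1, convPt e₀ 1 w.2) = (w.1, discPt e₀); rw [convPt_one]

/-- Lemma 2.18 topology (Hatcher VBKT §2.3). [folklore] -/
theorem homotopyA_apply (t : I) (w : DD d) : homotopyA e₀ (t, w) = (w.1, convPt e₀ t w.2) := rfl

/-- The homotopy preserves the face `∂D × D` at all times. [cite: HatcherVBKT2017, §2.3 proof of Lemma 2.18] -/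
theorem mapsTo_homotopyA (t : I) : MapsTo (fun w ↦ homotopyA e₀ (t, w)) (faceAC d : Set (DD d)) (faceAC d : Set (DD d)) :=
  fun _ hw ↦ hw

/-- **The linear homotopy of pairs `(DD, D × ∂D) → (DD, D × ∂D)` from the identity to
`(x, y) ↦ (e₀, y)`.** [cite: HatcherVBKT2017, §2.3 proof of Lemma 2.18] -/
def homotopyB : (ContinuousMap.id (DD d)).Homotopy ((sliceB e₀).comp ⟨fun w : DD d ↦ w.2, continuous_snd⟩) where
  toFun p := (convPt e₀ p.1 p.2.1, p.2.2)
  continuous_toFun := ((continuous_convPt e₀).comp (continuous_fst.prodMk (continuous_fst.comp continuous_snd))).prodMk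
    (continuous_snd.comp continuous_snd)
  map_zero_left w := by change (convPt e₀ 0 w.1, w.2) = w; rw [convPt_zero]
  map_one_left w := by change (convPt e₀ 1 w.1, w.2) = (discPt e₀, w.2); rw [convPt_one]

/-- Lemma 2.18 topology (Hatcher VBKT §2.3). [folklore] -/
theorem mapsTo_homotopyB (t : I) : MapsTo (fun w ↦ homotopyB e₀ (t, w)) (faceBC d : Set (DD d)) (faceBC d : Set (DD d)) :=
  fun _ hw ↦ hw

end Slices

/-! ### 4. Hemispheres as closed sets; `D/∂D ≅ Sᵈ/D₊ ≅ Sᵈ/D₋` -/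

section Hemispheres

/-- The closed upper hemisphere as a closed set. [folklore] -/
def hemiUpC (d : ℕ) : Closeds (SW d) := ⟨hemiUp d, isClosed_hemiUp⟩

/-- The closed lower hemisphere as a closed set. [folklore] -/
def hemiDnC (d : ℕ) : Closeds (SW d) := ⟨hemiDn d, isClosed_hemiDn⟩

/-- Lemma 2.18 topology (Hatcher VBKT §2.3). [folklore] -/
@[simp] theorem coe_hemiUpC : ((hemiUpC d : Closeds (SW d)) : Set (SW d)) = hemiUp d := rfl

/-- Lemma 2.18 topology (Hatcher VBKT §2.3). [folklore] -/
@[simp] theorem coe_hemiDnC : ((hemiDnC d : Closeds (SW d)) : Set (SW d)) = hemiDn d := rfl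

/-- Lemma 2.18 topology (Hatcher VBKT §2.3). [folklore] -/
instance contractibleSpace_hemiUpC : ContractibleSpace ↥((hemiUpC d : Closeds (SW d)) : Set (SW d)) := contractibleSpace_hemiUp

/-- Lemma 2.18 topology (Hatcher VBKT §2.3). [folklore] -/
instance contractibleSpace_hemiDnC : ContractibleSpace ↥((hemiDnC d : Closeds (SW d)) : Set (SW d)) := contractibleSpace_hemiDn

/-- The lower hemisphere embedding `x ↦ (x, -√(1 - |x|²))`. [folklore] -/
def embDn : C(Dd d, SW d) := (⟨Subtype.val, continuous_subtype_val⟩ : C(↥(hemiDn d), SW d)).comp discToHemiDn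

/-- The upper hemisphere embedding `y ↦ (y, √(1 - |y|²))`. [folklore] -/
def embUp : C(Dd d, SW d) := (⟨Subtype.val, continuous_subtype_val⟩ : C(↥(hemiUp d), SW d)).comp discToHemiUp

/-- Lemma 2.18 topology (Hatcher VBKT §2.3). [folklore] -/
theorem coe_embDn (x : Dd d) : ((embDn x : SW d) : Wd d) = WithLp.toLp 2 ((x : Vd d), -hgt x) := rfl

/-- Lemma 2.18 topology (Hatcher VBKT §2.3). [folklore] -/
theorem coe_embUp (y : Dd d) : ((embUp y : SW d) : Wd d) = WithLp.toLp 2 ((y : Vd d), hgt y) := rfl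

/-- Lemma 2.18 topology (Hatcher VBKT §2.3). [folklore] -/
theorem embDn_mem_hemiDn (x : Dd d) : embDn x ∈ hemiDn d := (discToHemiDn x).2

/-- Lemma 2.18 topology (Hatcher VBKT §2.3). [folklore] -/
theorem embUp_mem_hemiUp (y : Dd d) : embUp y ∈ hemiUp d := (discToHemiUp y).2

/-- Lemma 2.18 topology (Hatcher VBKT §2.3). [folklore] -/
theorem hgt_eq_zero_iff {x : Dd d} : hgt x = 0 ↔ ‖(x : Vd d)‖ = 1 := by
  have hx : ‖(x : Vd d)‖ ≤ 1 := mem_closedBall_zero_iff.1 x.2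
  rw [hgt, Real.sqrt_eq_zero', sub_nonpos]
  constructor
  · intro h; nlinarith [hx, norm_nonneg (x : Vd d)]
  · intro h; rw [h, one_pow]

/-- The boundary goes to the equator, which lies in `D₊`. [folklore] -/
theorem mapsTo_embDn : MapsTo embDn (sphC d : Set (Dd d)) (hemiUpC d : Set (SW d)) := by
  intro x hx
  change 0 ≤ ((embDn x : SW d) : Wd d).snd
  rw [coe_embDn, WithLp.toLp_snd, hgt_eq_zero_iff.2 hx, neg_zero]

/-- The boundary goes to the equator, which lies in `D₋`. [folklore] -/
theorem mapsTo_embUp : MapsTo embUp (sphC d : Set (Dd d)) (hemiDnC d : Set (SW d)) := by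
  intro y hy
  change ((embUp y : SW d) : Wd d).snd ≤ 0
  rw [coe_embUp, WithLp.toLp_snd, hgt_eq_zero_iff.2 hy]

/-- Lemma 2.18 topology (Hatcher VBKT §2.3). [folklore] -/
theorem embDn_mem_hemiUp_iff {x : Dd d} : embDn x ∈ hemiUp d ↔ x ∈ sphS d := by
  change 0 ≤ ((embDn x : SW d) : Wd d).snd ↔ ‖(x : Vd d)‖ = 1
  rw [coe_embDn, WithLp.toLp_snd, neg_nonneg, ← hgt_eq_zero_iff]
  exact ⟨fun h ↦ le_antisymm h (hgt_nonneg x), fun h ↦ h.le⟩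

/-- Lemma 2.18 topology (Hatcher VBKT §2.3). [folklore] -/
theorem embUp_mem_hemiDn_iff {y : Dd d} : embUp y ∈ hemiDn d ↔ y ∈ sphS d := by
  change ((embUp y : SW d) : Wd d).snd ≤ 0 ↔ ‖(y : Vd d)‖ = 1
  rw [coe_embUp, WithLp.toLp_snd, ← hgt_eq_zero_iff]
  exact ⟨fun h ↦ le_antisymm h (hgt_nonneg y), fun h ↦ h.le⟩

/-- Lemma 2.18 topology (Hatcher VBKT §2.3). [folklore] -/
theorem embDn_injective : Function.Injective (embDn (d := d)) := fun x x' h ↦ by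
  have h1 := congrArg (fun p : SW d ↦ (p : Wd d).fst) h
  simp only [coe_embDn, WithLp.toLp_fst] at h1
  exact Subtype.ext h1

/-- Lemma 2.18 topology (Hatcher VBKT §2.3). [folklore] -/
theorem embUp_injective : Function.Injective (embUp (d := d)) := fun y y' h ↦ by
  have h1 := congrArg (fun p : SW d ↦ (p : Wd d).fst) h
  simp only [coe_embUp, WithLp.toLp_fst] at h1
  exact Subtype.ext h1

/-- Lemma 2.18 topology (Hatcher VBKT §2.3). [folklore] -/
theorem embDn_hemiDnToDisc (p : ↥(hemiDn d)) : embDn (hemiDnToDisc p) = p := congrArg Subtype.val (hemiDnHomeo.left_inv p)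

/-- Lemma 2.18 topology (Hatcher VBKT §2.3). [folklore] -/
theorem embUp_hemiUpToDisc (p : ↥(hemiUp d)) : embUp (hemiUpToDisc p) = p := congrArg Subtype.val (hemiUpHomeo.left_inv p)

/-- Lemma 2.18 topology (Hatcher VBKT §2.3). [folklore] -/
theorem map_embDn_bijective : Function.Bijective (Collapse.map embDn mapsTo_embDn : DS d → Collapse (SW d) (hemiUpC d)) := by
  constructor
  · intro z z' h
    rcases Collapse.eq_pt_or_eq_mk z with rfl | ⟨x, hx, rfl⟩ <;> rcases Collapse.eq_pt_or_eq_mk z' with rfl | ⟨x', hx', rfl⟩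
    · rfl
    · exfalso
      rw [Collapse.map_pt, Collapse.map_mk, eq_comm, Collapse.mk_eq_pt_iff] at h
      exact hx' (embDn_mem_hemiUp_iff.1 h)
    · exfalso
      rw [Collapse.map_pt, Collapse.map_mk, Collapse.mk_eq_pt_iff] at h
      exact hx (embDn_mem_hemiUp_iff.1 h)
    · rw [Collapse.map_mk, Collapse.map_mk, Collapse.mk_eq_mk_iff] at h
      rcases h with h | ⟨h, -⟩
      · rw [embDn_injective h]
      · exact absurd (embDn_mem_hemiUp_iff.1 h) hx
  · intro z
    rcases Collapse.eq_pt_or_eq_mk z with rfl | ⟨p, hp, rfl⟩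
    · exact ⟨Collapse.pt _, rfl⟩
    · have hp' : p ∈ hemiDn d := by
        have : ¬ (0 ≤ (p : Wd d).snd) := hp
        exact (lt_of_not_ge this).le
      refine ⟨Collapse.mk _ (hemiDnToDisc ⟨p, hp'⟩), ?_⟩
      rw [Collapse.map_mk, embDn_hemiDnToDisc]

/-- Lemma 2.18 topology (Hatcher VBKT §2.3). [folklore] -/
theorem map_embUp_bijective : Function.Bijective (Collapse.map embUp mapsTo_embUp : DS d → Collapse (SW d) (hemiDnC d)) := by
  constructor
  · intro z z' h
    rcases Collapse.eq_pt_or_eq_mk z with rfl | ⟨y, hy, rfl⟩ <;> rcases Collapse.eq_pt_or_eq_mk z' with rfl | ⟨y', hy', rfl⟩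
    · rfl
    · exfalso
      rw [Collapse.map_pt, Collapse.map_mk, eq_comm, Collapse.mk_eq_pt_iff] at h
      exact hy' (embUp_mem_hemiDn_iff.1 h)
    · exfalso
      rw [Collapse.map_pt, Collapse.map_mk, Collapse.mk_eq_pt_iff] at h
      exact hy (embUp_mem_hemiDn_iff.1 h)
    · rw [Collapse.map_mk, Collapse.map_mk, Collapse.mk_eq_mk_iff] at h
      rcases h with h | ⟨h, -⟩
      · rw [embUp_injective h]
      · exact absurd (embUp_mem_hemiDn_iff.1 h) hy
  · intro z
    rcases Collapse.eq_pt_or_eq_mk z with rfl | ⟨p, hp, rfl⟩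
    · exact ⟨Collapse.pt _, rfl⟩
    · have hp' : p ∈ hemiUp d := by
        have : ¬ ((p : Wd d).snd ≤ 0) := hp
        exact (lt_of_not_ge this).le
      refine ⟨Collapse.mk _ (hemiUpToDisc ⟨p, hp'⟩), ?_⟩
      rw [Collapse.map_mk, embUp_hemiUpToDisc]

/-- **`D/∂D ≃ₜ Sᵈ/D₊`** (lower hemisphere embedding). [cite: HatcherVBKT2017, §2.3 proof of Lemma 2.18] -/
def lamA : DS d ≃ₜ Collapse (SW d) (hemiUpC d) :=
  Continuous.homeoOfEquivCompactToT2 (f := Equiv.ofBijective _ map_embDn_bijective) (Collapse.map embDn mapsTo_embDn).continuous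

/-- **`D/∂D ≃ₜ Sᵈ/D₋`** (upper hemisphere embedding). [cite: HatcherVBKT2017, §2.3 proof of Lemma 2.18] -/
def lamB : DS d ≃ₜ Collapse (SW d) (hemiDnC d) :=
  Continuous.homeoOfEquivCompactToT2 (f := Equiv.ofBijective _ map_embUp_bijective) (Collapse.map embUp mapsTo_embUp).continuous

/-- Lemma 2.18 topology (Hatcher VBKT §2.3). [folklore] -/
theorem coe_lamA : ((lamA : DS d ≃ₜ Collapse (SW d) (hemiUpC d)) : C(DS d, Collapse (SW d) (hemiUpC d))) = Collapse.map embDn mapsTo_embDn := rfl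

/-- Lemma 2.18 topology (Hatcher VBKT §2.3). [folklore] -/
theorem coe_lamB : ((lamB : DS d ≃ₜ Collapse (SW d) (hemiDnC d)) : C(DS d, Collapse (SW d) (hemiDnC d))) = Collapse.map embUp mapsTo_embUp := rfl

/-- Lemma 2.18 topology (Hatcher VBKT §2.3). [folklore] -/
@[simp] theorem lamA_pt : lamA (dsPt d) = Collapse.pt (hemiUpC d) := rfl

/-- Lemma 2.18 topology (Hatcher VBKT §2.3). [folklore] -/
@[simp] theorem lamB_pt : lamB (dsPt d) = Collapse.pt (hemiDnC d) := rfl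

end Hemispheres

/-! ### 5. Deforming `ĝ(·, e₀)` into the hemisphere embedding through an `H`-space homotopy -/

section Tau

variable (g : C(Sd1 d × Sd1 d, Sd1 d)) (e₀ : Sd1 d)

/-- Lemma 2.18 topology (Hatcher VBKT §2.3). [folklore] -/
theorem udir_coe_sphere (u : Sd1 d) : udir e₀ (u : Vd d) = u := by
  apply Subtype.ext
  rw [udir_of_ne_zero e₀ (ne_zero_of_mem_unitSphere u), mem_sphere_zero_iff_norm.1 u.2, inv_one, one_smul]

/-- Lemma 2.18 topology (Hatcher VBKT §2.3). [folklore] -/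
theorem norm_smul_udir (x : Vd d) : ‖x‖ • (udir e₀ x : Vd d) = x := by
  rcases eq_or_ne x 0 with rfl | hx
  · rw [norm_zero, zero_smul]
  · rw [udir_of_ne_zero e₀ hx, smul_smul, mul_inv_cancel₀ (norm_ne_zero_iff.2 hx), one_smul]

/-- The vector part `|x| K(t, x/|x|)` of the deformation. [folklore] -/
def tauVec (K : C(I × Sd1 d, Sd1 d)) (p : I × Dd d) : Vd d := ‖(p.2 : Vd d)‖ • (K (p.1, udir e₀ (p.2 : Vd d)) : Vd d)

/-- Lemma 2.18 topology (Hatcher VBKT §2.3). [folklore] -/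
theorem norm_tauVec (K : C(I × Sd1 d, Sd1 d)) (p : I × Dd d) : ‖tauVec e₀ K p‖ = ‖(p.2 : Vd d)‖ := by
  rw [tauVec, norm_smul, norm_norm, mem_sphere_zero_iff_norm.1 (K _).2, mul_one]

/-- Continuity of `|x| K(t, x/|x|)` (at `x = 0` by the norm squeeze). [folklore] -/
theorem continuous_tauVec (K : C(I × Sd1 d, Sd1 d)) : Continuous (tauVec e₀ K) := by
  rw [continuous_iff_continuousAt]
  rintro ⟨t, x⟩
  by_cases hx : (x : Vd d) ≠ 0
  · apply ContinuousAt.smul ((continuous_norm.comp (continuous_subtype_val.comp continuous_snd)).continuousAt)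
    have h1 : ContinuousAt (fun p : I × Dd d ↦ (p.1, udir e₀ (p.2 : Vd d))) (t, x) :=
      continuous_fst.continuousAt.prodMk (ContinuousAt.comp (f := fun p : I × Dd d ↦ (p.2 : Vd d)) (continuousAt_udir e₀ hx)
        (continuous_subtype_val.comp continuous_snd).continuousAt)
    exact continuous_subtype_val.continuousAt.comp (K.continuous.continuousAt.comp h1)
  · rw [not_not] at hx
    have h0 : tauVec e₀ K (t, x) = 0 := by rw [tauVec, hx, norm_zero, zero_smul]
    rw [ContinuousAt, h0]
    refine squeeze_zero_norm (fun p ↦ (norm_tauVec e₀ K p).le) ?_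
    have := (continuous_norm.comp (continuous_subtype_val.comp (continuous_snd (X := I) (Y := Dd d)))).tendsto (t, x)
    simp only [Function.comp_apply, hx, norm_zero] at this
    exact this

/-- Lemma 2.18 topology (Hatcher VBKT §2.3). [folklore] -/
theorem norm_toLp_tauVec (K : C(I × Sd1 d, Sd1 d)) (p : I × Dd d) (s : ℝ) (hs : s ^ 2 = hgt p.2 ^ 2) :
    ‖WithLp.toLp 2 (tauVec e₀ K p, s)‖ = 1 := by
  have h : ‖WithLp.toLp 2 (tauVec e₀ K p, s)‖ ^ 2 = 1 := by
    rw [WithLp.prod_norm_sq_eq_of_L2, WithLp.toLp_fst, WithLp.toLp_snd, norm_tauVec, Real.norm_eq_abs, sq_abs, hs, hgt_sq]; ring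
  exact (sq_eq_sq₀ (norm_nonneg _) zero_le_one).1 (by rw [one_pow]; exact h)

/-- The family `(t, x) ↦ (|x| K(t, x/|x|), -√(1 - |x|²)) ∈ Sᵈ`. [cite: HatcherVBKT2017, §2.3 proof of Lemma 2.18] -/
def tauDn (K : C(I × Sd1 d, Sd1 d)) : C(I × Dd d, SW d) :=
  ⟨fun p ↦ ⟨WithLp.toLp 2 (tauVec e₀ K p, -hgt p.2), mem_sphere_zero_iff_norm.2 (norm_toLp_tauVec e₀ K p _ (neg_sq _))⟩,
    ((WithLp.prod_continuous_toLp 2 (Vd d) ℝ).comp ((continuous_tauVec e₀ K).prodMk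
      ((continuous_hgt.comp continuous_snd).neg))).subtype_mk _⟩

/-- The family `(t, y) ↦ (|y| K(t, y/|y|), +√(1 - |y|²)) ∈ Sᵈ`. [cite: HatcherVBKT2017, §2.3 proof of Lemma 2.18] -/
def tauUp (K : C(I × Sd1 d, Sd1 d)) : C(I × Dd d, SW d) :=
  ⟨fun p ↦ ⟨WithLp.toLp 2 (tauVec e₀ K p, hgt p.2), mem_sphere_zero_iff_norm.2 (norm_toLp_tauVec e₀ K p _ rfl)⟩,
    ((WithLp.prod_continuous_toLp 2 (Vd d) ℝ).comp ((continuous_tauVec e₀ K).prodMk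
      (continuous_hgt.comp continuous_snd))).subtype_mk _⟩

/-- Lemma 2.18 topology (Hatcher VBKT §2.3). [folklore] -/
theorem coe_tauDn (K : C(I × Sd1 d, Sd1 d)) (p : I × Dd d) : ((tauDn e₀ K p : SW d) : Wd d) = WithLp.toLp 2 (tauVec e₀ K p, -hgt p.2) := rfl

/-- Lemma 2.18 topology (Hatcher VBKT §2.3). [folklore] -/
theorem coe_tauUp (K : C(I × Sd1 d, Sd1 d)) (p : I × Dd d) : ((tauUp e₀ K p : SW d) : Wd d) = WithLp.toLp 2 (tauVec e₀ K p, hgt p.2) := rfl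

/-- At all times the boundary goes to the equator (`⊆ D₊`). [folklore] -/
theorem mapsTo_tauDn (K : C(I × Sd1 d, Sd1 d)) (t : I) : MapsTo (fun x ↦ tauDn e₀ K (t, x)) (sphC d : Set (Dd d)) (hemiUpC d : Set (SW d)) := by
  intro x hx
  change 0 ≤ ((tauDn e₀ K (t, x) : SW d) : Wd d).snd
  rw [coe_tauDn, WithLp.toLp_snd]
  change 0 ≤ -hgt x
  rw [hgt_eq_zero_iff.2 hx, neg_zero]

/-- At all times the boundary goes to the equator (`⊆ D₋`). [folklore] -/
theorem mapsTo_tauUp (K : C(I × Sd1 d, Sd1 d)) (t : I) : MapsTo (fun y ↦ tauUp e₀ K (t, y)) (sphC d : Set (Dd d)) (hemiDnC d : Set (SW d)) := by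
  intro y hy
  change ((tauUp e₀ K (t, y) : SW d) : Wd d).snd ≤ 0
  rw [coe_tauUp, WithLp.toLp_snd]
  change hgt y ≤ 0
  rw [hgt_eq_zero_iff.2 hy]

/-- `ĝ` on the slice `(x, e₀)`: the boundary value as a map `D → Sᵈ`. [cite: HatcherVBKT2017, §2.3 proof of Lemma 2.18] -/
def tauA0 : C(Dd d, SW d) :=
  ⟨fun x ↦ bdryVal g e₀ (sliceA e₀ x) (rad_sliceA e₀ x), ((continuous_theta2 g e₀).comp (sliceA e₀).continuous).subtype_mk _⟩

/-- `ĝ` on the slice `(e₀, y)`. [cite: HatcherVBKT2017, §2.3 proof of Lemma 2.18] -/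
def tauB0 : C(Dd d, SW d) :=
  ⟨fun y ↦ bdryVal g e₀ (sliceB e₀ y) (rad_sliceB e₀ y), ((continuous_theta2 g e₀).comp (sliceB e₀).continuous).subtype_mk _⟩

/-- **`Φ(x, e₀) = j(ĝ(x, e₀))`** as maps. [cite: HatcherVBKT2017, §2.3 Lemma 2.18] -/
theorem conePhi_comp_sliceA : (conePhi g e₀).comp (sliceA e₀) = (coneJ g e₀).comp (tauA0 g e₀) := by
  ext1 x; exact conePhi_eq_coneJ g e₀ (rad_sliceA e₀ x)

/-- **`Φ(e₀, y) = j(ĝ(e₀, y))`** as maps. [cite: HatcherVBKT2017, §2.3 Lemma 2.18] -/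
theorem conePhi_comp_sliceB : (conePhi g e₀).comp (sliceB e₀) = (coneJ g e₀).comp (tauB0 g e₀) := by
  ext1 y; exact conePhi_eq_coneJ g e₀ (rad_sliceB e₀ y)

/-- Lemma 2.18 topology (Hatcher VBKT §2.3). [folklore] -/
theorem hopfVec_sliceA (x : Dd d) : hopfVec g e₀ (sliceA e₀ x) = ‖(x : Vd d)‖ • (g (udir e₀ (x : Vd d), e₀) : Vd d) := by
  rw [sliceA_apply, hopfVec]
  change min ‖(x : Vd d)‖ ‖((discPt e₀ : Dd d) : Vd d)‖ • (g (udir e₀ (x : Vd d), udir e₀ ((discPt e₀ : Dd d) : Vd d)) : Vd d) = _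
  rw [norm_discPt, min_eq_left (mem_closedBall_zero_iff.1 x.2), coe_discPt, udir_coe_sphere]

/-- Lemma 2.18 topology (Hatcher VBKT §2.3). [folklore] -/
theorem hopfVec_sliceB (y : Dd d) : hopfVec g e₀ (sliceB e₀ y) = ‖(y : Vd d)‖ • (g (e₀, udir e₀ (y : Vd d)) : Vd d) := by
  rw [sliceB_apply, hopfVec]
  change min ‖((discPt e₀ : Dd d) : Vd d)‖ ‖(y : Vd d)‖ • (g (udir e₀ ((discPt e₀ : Dd d) : Vd d), udir e₀ (y : Vd d)) : Vd d) = _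
  rw [norm_discPt, min_eq_right (mem_closedBall_zero_iff.1 y.2), coe_discPt, udir_coe_sphere]

/-- Lemma 2.18 topology (Hatcher VBKT §2.3). [folklore] -/
theorem theta2_snd_sliceA (x : Dd d) : (theta2 g e₀ (sliceA e₀ x)).snd = -hgt x := by
  rw [theta2_snd, sliceA_apply]
  change ssqrt (‖(x : Vd d)‖ ^ 2 - ‖((discPt e₀ : Dd d) : Vd d)‖ ^ 2) = -hgt x
  have hx : ‖(x : Vd d)‖ ^ 2 ≤ 1 := by
    have := mem_closedBall_zero_iff.1 x.2; nlinarith [norm_nonneg (x : Vd d)]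
  rw [norm_discPt, one_pow, ssqrt_of_nonpos (by linarith), neg_sub, hgt]

/-- Lemma 2.18 topology (Hatcher VBKT §2.3). [folklore] -/
theorem theta2_snd_sliceB (y : Dd d) : (theta2 g e₀ (sliceB e₀ y)).snd = hgt y := by
  rw [theta2_snd, sliceB_apply]
  change ssqrt (‖((discPt e₀ : Dd d) : Vd d)‖ ^ 2 - ‖(y : Vd d)‖ ^ 2) = hgt y
  have hy : ‖(y : Vd d)‖ ^ 2 ≤ 1 := by
    have := mem_closedBall_zero_iff.1 y.2; nlinarith [norm_nonneg (y : Vd d)]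
  rw [norm_discPt, one_pow, ssqrt_of_nonneg (by linarith), hgt]

/-- `ĝ(x, e₀) = (|x| g(x/|x|, e₀), -√(1 - |x|²))`. [cite: HatcherVBKT2017, §2.3 Lemma 2.18] -/
theorem coe_tauA0 (x : Dd d) : ((tauA0 g e₀ x : SW d) : Wd d) = WithLp.toLp 2 (‖(x : Vd d)‖ • (g (udir e₀ (x : Vd d), e₀) : Vd d), -hgt x) := by
  change theta2 g e₀ (sliceA e₀ x) = _
  rw [← hopfVec_sliceA g e₀ x, ← theta2_snd_sliceA g e₀ x]
  rfl

/-- `ĝ(e₀, y) = (|y| g(e₀, y/|y|), √(1 - |y|²))`. [cite: HatcherVBKT2017, §2.3 Lemma 2.18] -/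
theorem coe_tauB0 (y : Dd d) : ((tauB0 g e₀ y : SW d) : Wd d) = WithLp.toLp 2 (‖(y : Vd d)‖ • (g (e₀, udir e₀ (y : Vd d)) : Vd d), hgt y) := by
  change theta2 g e₀ (sliceB e₀ y) = _
  rw [← hopfVec_sliceB g e₀ y, ← theta2_snd_sliceB g e₀ y]
  rfl

/-- **The `H`-space unit homotopy deforms `ĝ(·, e₀)` into the lower hemisphere embedding**, as a
homotopy of maps of pairs `(D, ∂D) → (Sᵈ, D₊)`. [cite: HatcherVBKT2017, §2.3 proof of Lemma 2.18] -/
def homotopyTauA (K : C(I × Sd1 d, Sd1 d)) (hK0 : ∀ u, K (0, u) = g (u, e₀)) (hK1 : ∀ u, K (1, u) = u) :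
    (tauA0 g e₀).Homotopy embDn where
  toFun := tauDn e₀ K
  continuous_toFun := (tauDn e₀ K).continuous
  map_zero_left x := by
    apply Subtype.ext
    rw [coe_tauA0]
    change WithLp.toLp 2 (tauVec e₀ K (0, x), -hgt x) = _
    rw [tauVec, hK0]
  map_one_left x := by
    apply Subtype.ext
    rw [coe_embDn]
    change WithLp.toLp 2 (tauVec e₀ K (1, x), -hgt x) = _
    rw [tauVec, hK1, norm_smul_udir]

/-- **The `H`-space unit homotopy deforms `ĝ(e₀, ·)` into the upper hemisphere embedding**, as a
homotopy of maps of pairs `(D, ∂D) → (Sᵈ, D₋)`. [cite: HatcherVBKT2017, §2.3 proof of Lemma 2.18] -/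
def homotopyTauB (K : C(I × Sd1 d, Sd1 d)) (hK0 : ∀ u, K (0, u) = g (e₀, u)) (hK1 : ∀ u, K (1, u) = u) :
    (tauB0 g e₀).Homotopy embUp where
  toFun := tauUp e₀ K
  continuous_toFun := (tauUp e₀ K).continuous
  map_zero_left y := by
    apply Subtype.ext
    rw [coe_tauB0]
    change WithLp.toLp 2 (tauVec e₀ K (0, y), hgt y) = _
    rw [tauVec, hK0]
  map_one_left y := by
    apply Subtype.ext
    rw [coe_embUp]
    change WithLp.toLp 2 (tauVec e₀ K (1, y), hgt y) = _
    rw [tauVec, hK1, norm_smul_udir]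

/-- Lemma 2.18 topology (Hatcher VBKT §2.3). [folklore] -/
theorem homotopyTauA_apply (K : C(I × Sd1 d, Sd1 d)) (hK0 : ∀ u, K (0, u) = g (u, e₀)) (hK1 : ∀ u, K (1, u) = u) (p : I × Dd d) :
    homotopyTauA g e₀ K hK0 hK1 p = tauDn e₀ K p := rfl

/-- Lemma 2.18 topology (Hatcher VBKT §2.3). [folklore] -/
theorem homotopyTauB_apply (K : C(I × Sd1 d, Sd1 d)) (hK0 : ∀ u, K (0, u) = g (e₀, u)) (hK1 : ∀ u, K (1, u) = u) (p : I × Dd d) :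
    homotopyTauB g e₀ K hK0 hK1 p = tauUp e₀ K p := rfl

/-! ### The equator base point and the decomposition `S = D₊ ∪ D₋` -/

/-- The base point `E₀ = (e₀, 0)` of `Sᵈ` on the equator. [folklore] -/
def eqBase : SW d := embDn (discPt e₀)

/-- Lemma 2.18 topology (Hatcher VBKT §2.3). [folklore] -/
theorem eqBase_mem_hemiUp : eqBase e₀ ∈ hemiUp d := mapsTo_embDn (discPt_mem_sphS e₀)

/-- Lemma 2.18 topology (Hatcher VBKT §2.3). [folklore] -/
theorem eqBase_mem_hemiDn : eqBase e₀ ∈ hemiDn d := embDn_mem_hemiDn _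

/-- Lemma 2.18 topology (Hatcher VBKT §2.3). [folklore] -/
theorem embUp_discPt : embUp (discPt e₀) = eqBase e₀ := by
  apply Subtype.ext
  rw [coe_embUp, eqBase, coe_embDn, hgt_eq_zero_iff.2 (discPt_mem_sphS e₀), neg_zero]

/-- **`S = D₊ ∪ D₋`** as closed sets of the cone. [folklore] -/
theorem coneDupC_sup_coneDdnC : coneDupC g e₀ ⊔ coneDdnC g e₀ = coneSC g e₀ := by
  apply SetLike.coe_injective
  rw [Closeds.coe_sup]
  exact coneDup_union_coneDdn g e₀

/-- Lemma 2.18 topology (Hatcher VBKT §2.3). [folklore] -/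
theorem mapsTo_coneJ_hemiUpC : MapsTo (coneJ g e₀) (hemiUpC d : Set (SW d)) (coneDupC g e₀ : Set (Cone g e₀)) := fun p hp ↦ ⟨p, hp, rfl⟩

/-- Lemma 2.18 topology (Hatcher VBKT §2.3). [folklore] -/
theorem mapsTo_coneJ_hemiDnC : MapsTo (coneJ g e₀) (hemiDnC d : Set (SW d)) (coneDdnC g e₀ : Set (Cone g e₀)) := fun p hp ↦ ⟨p, hp, rfl⟩

/-- Lemma 2.18 topology (Hatcher VBKT §2.3). [folklore] -/
theorem coneJ_eqBase_mem_coneDupC : coneJ g e₀ (eqBase e₀) ∈ (coneDupC g e₀ : Set (Cone g e₀)) := mapsTo_coneJ_hemiUpC g e₀ (eqBase_mem_hemiUp e₀)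

/-- Lemma 2.18 topology (Hatcher VBKT §2.3). [folklore] -/
theorem coneJ_eqBase_mem_coneDdnC : coneJ g e₀ (eqBase e₀) ∈ (coneDdnC g e₀ : Set (Cone g e₀)) := mapsTo_coneJ_hemiDnC g e₀ (eqBase_mem_hemiDn e₀)

/-- Lemma 2.18 topology (Hatcher VBKT §2.3). [folklore] -/
theorem coneJ_eqBase_mem_coneSC : coneJ g e₀ (eqBase e₀) ∈ (coneSC g e₀ : Set (Cone g e₀)) := coneJ_mem_coneS g e₀ _

/-- Lemma 2.18 topology (Hatcher VBKT §2.3). [folklore] -/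
theorem mapsTo_conePhi_faces : MapsTo (conePhi g e₀) ((faceAC d ⊔ faceBC d : Closeds (DD d)) : Set (DD d))
    ((coneDupC g e₀ ⊔ coneDdnC g e₀ : Closeds (Cone g e₀)) : Set (Cone g e₀)) := by
  intro w hw
  rw [Closeds.coe_sup] at hw ⊢
  rcases hw with hw | hw
  · exact Or.inl (mapsTo_conePhi_faceA g e₀ hw)
  · exact Or.inr (mapsTo_conePhi_faceB g e₀ hw)

end Tau

end Literature.AlgebraicTopology.KTheory

end
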